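import Summits.QuantumFields.YangMills.Theorems.UnitScaleTiltProp8HalvingDressedCriticalitySU2
import HarnessLib

/-!
# Route `UnitScaleTilt`, crux K1 child «MinimiserStabilityRegPr» (stmt-QuantumFields-19200), registered stub `stub_halvingStep` (H), the S11∕S12 junction of the
# end-to-end knit — **THE LOCALISED COMPETITOR MAP: ACTION SPLITTING AND THE LOCAL S11** (LEAD ★w5-19200 g4 RULING L-1 (R3) «LOCALISE THE COMPETITOR MAP»,
# 2026-08-28T09:51:17Z; census #45 rows (R3)-(L2) and the `hpair` producer)

Cell `ym3-torus` (HUMAN RULING D-0037, YM ladder rung R3 — continuum SU(2) YM₃ on the torus is a RUNG, not the Clay problem), width seat `ym-ust-19200-w1` gen 7.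
`--supports stmt-QuantumFields-19200 --as helper`; def-free, 0 sorry, standard axioms; counts toward nothing by itself.

WHY.  ✓`HalvingDressedCriticalitySU2.tracePairing_of_isMinOn_dressed_wilson_su2` (S11) reads the minimiser through a competitor map `U X` that is the exponential chart
`↑(U X)(b) = e^{iη(X − H(D X))(b)}` on EVERY bond of the torus; the pillar P1♭ of record (✓`HalvingP1FlatPillar.P1FlatPillarAt` (ii)) supplies the chart identity
`u⁻¹Uu = e^{iηA}` only on the layers `SideTouches (pullDom {InOm j} j)`, `1 ≤ j ≤ k` — on the far torus `Λ₀ = T ∖ blocks(Ω₁)` no gauge copy of the minimiser is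
`O(ε₀)`-close to `1` (free holonomies), so a GLOBAL chart identity is uninhabitable (LEAD RULING L-1, census #45 (R3)).  The competitor map of record is therefore LOCAL:
the chart on the region, the minimiser's (fixed) gauge copy off it.  This file proves that NOTHING in S11's conclusion changes: because every competitor in S11's set `T` is
PINNED off the region (index data at level `0` are the bond values themselves, `Q₀ = id`; census (L1) — supplied by the knit, displayed here as the hypothesis `hoff`), the
tree's `wilsonAction4` of the local competitor and the real part of the GLOBAL holomorphic chart action `𝒮_η(X − H(D X))` differ by a constant on `T` (plaquette by
plaquette: on a plaquette whose four sides carry the chart they AGREE — ✓`FlatActionGradient.wilsonAction4_eq_re_action`'s per-plaquette step; on any other plaquette both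
are X-INDEPENDENT), so a minimum of `wilsonAction4 ∘ Φ` over `T` is a minimum of `Re 𝒮_η ∘ dress` over `T`, and the Lie-algebra-level ✓`tracePairing_of_isMinOn_dressed_su2`
(the lemma S11 itself reduces to) yields the trace pairing `hpair` IN `HalvingSitePackage.sitePackage_of_rows_L5`'s VERBATIM GLOBAL SHAPE.

WHAT IS PROVED (ns `…Theorems.HalvingCompetitorMapAction`; any `P`, level `j` for §1–§2, the fine torus `PBond P 0` for §3–§4; `M₂ = Matrix (Fin 2) (Fin 2) ℂ`).
* §1 `one_sub_reTr_plaqHol_eq_re` — ONE plaquette: if the four bond variables of `p` are `e^{iηA(b)}` with `A` self-adjoint on the two inverted sides, then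
  `1 − reTr U(∂p) = Re(1 − ½ tr(e^{iηA₁}e^{iηA₂}e^{−iηA₃}e^{−iηA₄}))`.
* §2 ★ `wilsonAction4_sub_re_action_eq` — ACTION SPLITTING for an arbitrary plaquette predicate `Tch` («touches the region»): two pairs `(U, A)`, `(U₀, A₀)` that carry the
  chart on every `Tch`-plaquette and AGREE bondwise on every non-`Tch` plaquette have the same `wilsonAction4 U − Re 𝒮_η(A)`.
* §3 `isMinOn_re_action_of_isMinOn_wilsonAction4` — a minimum of `X ↦ wilsonAction4 (Φ X)` over `T` at `A ∈ T` is a minimum of `X ↦ Re 𝒮_η(Y X)` over `T` when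
  `wilsonAction4 (Φ X) − Re 𝒮_η(Y X)` is constant on `T`.
* §4 ★★ `tracePairing_of_isMinOn_localChart` — S11 FOR THE LOCALISED COMPETITOR MAP: ✓`tracePairing_of_isMinOn_dressed_wilson_su2` with its global chart hypothesis `hU`
  replaced by {`hexp`: the chart on the sides of `Tch`-plaquettes; `hoff`: off them the competitor and its dressed field agree with those of the minimiser `A`}; SAME
  conclusion (the `hpair` binder of `sitePackage_of_rows_L5`, test fields `s` with `Q s = 0`, traceless self-adjoint `Et`).
HONEST SCOPE: exact first-order calculus and finite sums; the competitor map, `H`, `D`, `W₀`, `E`, the pinning `hoff` and the minimality are hypotheses (the knit's (L1), FILE E,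
✓`hmin_of_hcrit` + the fibre half of (Φ-1)); nothing of print is asserted; NOT a claim about the stub, the crux, the rung or a mass gap.

References: T. Bałaban, CMP **102** (1985) 277–309 [Balaban1985Variational] ((5) p.278, (47) p.285, (80)–(89) pp.290–291, (99)–(100) p.293, (150) p.301 («we restrict U′_k
to a neighborhood … the minimum of the action restricted to this neighborhood»), (157)–(158) p.302); CMP **99** (1985) 75–102 [Balaban1985RegularSpaces] (p.77, the «sides
touching S» convention before (1.5)).
-/

set_option autoImplicit false

noncomputable section

open scoped BigOperators Matrix Matrix.Norms.L2Operator
open NormedSpace Finset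

namespace Summit.QuantumFields.YangMills.Theorems.HalvingCompetitorMapAction

open Literature.MathematicalPhysics.QuantumFieldTheory.Balaban1983to89
open B6SectADomainsV1 (Domains)
open B6SectAOperatorsV1 (BondIdx QE)
open LatticeFieldCalculus (bondAvgIter)
open FlatActionGradient (coe_inv_eq_exp_neg)
open HalvingDressedCriticalitySU2 (tracePairing_of_isMinOn_dressed_su2)

variable {P : Params} {j : ℕ}

/-! ## §1 One plaquette in the exponential chart -/

section OnePlaquette

variable (η : ℝ)

/-- **ONE PLAQUETTE IN THE CHART**: if the four bond variables of `p` are `e^{iηA(b)}` (`A` self-adjoint on the two sides entering inverted), then the tree's plaquette term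
`1 − reTr U(∂p)` (`Setup.wilsonAction`, `UnitaryModel` trace `½Re tr`) is the real part of the holomorphic term `1 − ½tr(e^{iηA₁}e^{iηA₂}e^{−iηA₃}e^{−iηA₄})` — the
per-plaquette step of ✓`FlatActionGradient.wilsonAction4_eq_re_action`. [cite: Balaban1985Variational, (5) p.278, (157) p.302] -/
theorem one_sub_reTr_plaqHol_eq_re (A : PBond P j → Matrix (Fin 2) (Fin 2) ℂ) (U : GaugeField P j (Matrix.specialUnitaryGroup (Fin 2) ℂ)) (p : Plaq P j)
    (h₁ : ((U ⟨p.src, p.μ⟩ : Matrix.specialUnitaryGroup (Fin 2) ℂ) : Matrix (Fin 2) (Fin 2) ℂ) = exp ((Complex.I * (η : ℂ)) • A ⟨p.src, p.μ⟩))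
    (h₂ : ((U ⟨p.src.shift p.μ, p.ν⟩ : Matrix.specialUnitaryGroup (Fin 2) ℂ) : Matrix (Fin 2) (Fin 2) ℂ) = exp ((Complex.I * (η : ℂ)) • A ⟨p.src.shift p.μ, p.ν⟩))
    (h₃ : ((U ⟨p.src.shift p.ν, p.μ⟩ : Matrix.specialUnitaryGroup (Fin 2) ℂ) : Matrix (Fin 2) (Fin 2) ℂ) = exp ((Complex.I * (η : ℂ)) • A ⟨p.src.shift p.ν, p.μ⟩))
    (h₄ : ((U ⟨p.src, p.ν⟩ : Matrix.specialUnitaryGroup (Fin 2) ℂ) : Matrix (Fin 2) (Fin 2) ℂ) = exp ((Complex.I * (η : ℂ)) • A ⟨p.src, p.ν⟩))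
    (hsa₃ : IsSelfAdjoint (A ⟨p.src.shift p.ν, p.μ⟩)) (hsa₄ : IsSelfAdjoint (A ⟨p.src, p.ν⟩)) :
    1 - reTr (GaugeField.plaqHol U p) =
      (1 - (2 : ℂ)⁻¹ * Matrix.trace (exp ((Complex.I * (η : ℂ)) • A ⟨p.src, p.μ⟩) * exp ((Complex.I * (η : ℂ)) • A ⟨p.src.shift p.μ, p.ν⟩) *
        exp (-((Complex.I * (η : ℂ)) • A ⟨p.src.shift p.ν, p.μ⟩)) * exp (-((Complex.I * (η : ℂ)) • A ⟨p.src, p.ν⟩)))).re := by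
  rw [show reTr (GaugeField.plaqHol U p) = (((GaugeField.plaqHol U p : Matrix.specialUnitaryGroup (Fin 2) ℂ) : Matrix (Fin 2) (Fin 2) ℂ).trace).re / 2 from by
    show UnitaryModel.nReTr (Literature.MathematicalPhysics.QuantumLattice.fundamentalRep (Fin 2) _) = _
    simp [UnitaryModel.nReTr, Literature.MathematicalPhysics.QuantumLattice.fundamentalRep_apply]]
  have hhol : ((GaugeField.plaqHol U p : Matrix.specialUnitaryGroup (Fin 2) ℂ) : Matrix (Fin 2) (Fin 2) ℂ) =
      exp ((Complex.I * (η : ℂ)) • A ⟨p.src, p.μ⟩) * exp ((Complex.I * (η : ℂ)) • A ⟨p.src.shift p.μ, p.ν⟩) *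
        exp (-((Complex.I * (η : ℂ)) • A ⟨p.src.shift p.ν, p.μ⟩)) * exp (-((Complex.I * (η : ℂ)) • A ⟨p.src, p.ν⟩)) := by
    unfold GaugeField.plaqHol
    rw [Submonoid.coe_mul, Submonoid.coe_mul, Submonoid.coe_mul, h₁, h₂, coe_inv_eq_exp_neg η hsa₃ _ h₃, coe_inv_eq_exp_neg η hsa₄ _ h₄]
  rw [hhol]
  simp only [Complex.sub_re, Complex.one_re, Complex.mul_re, Complex.inv_re, Complex.inv_im]
  norm_num
  ring

end OnePlaquette

/-! ## §2 Action splitting: the Wilson action of a local competitor minus `Re 𝒮_η` of its dressed field is constant -/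

section Split

variable (η : ℝ)

/-- ★ **ACTION SPLITTING.**  `Tch` any plaquette predicate («touches the chart region»).  Two pairs `(U, A)`, `(U₀, A₀)` of an `SU(2)` configuration and a bondwise
self-adjoint one-form such that (a) on every `Tch`-plaquette the four bond variables of `U` resp. `U₀` are `e^{iηA(b)}` resp. `e^{iηA₀(b)}`, and (b) on every other plaquette
the four bond variables of `U`, `U₀` COINCIDE and so do those of `A`, `A₀`.  Then `wilsonAction4 U − Re 𝒮_η(A) = wilsonAction4 U₀ − Re 𝒮_η(A₀)` (`𝒮_η` the GLOBAL holomorphic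
plaquette action of ✓`FlatActionGradient`): chart plaquettes contribute `0 − 0`, the others the same constant on both sides.
[cite: Balaban1985Variational, (5) p.278, (150) p.301, (157) p.302] -/
theorem wilsonAction4_sub_re_action_eq (Tch : Plaq P j → Prop) (A A₀ : PBond P j → Matrix (Fin 2) (Fin 2) ℂ)
    (U U₀ : GaugeField P j (Matrix.specialUnitaryGroup (Fin 2) ℂ)) (hsa : ∀ b, IsSelfAdjoint (A b)) (hsa₀ : ∀ b, IsSelfAdjoint (A₀ b))
    (hexp : ∀ p, Tch p →
      ((U ⟨p.src, p.μ⟩ : Matrix.specialUnitaryGroup (Fin 2) ℂ) : Matrix (Fin 2) (Fin 2) ℂ) = exp ((Complex.I * (η : ℂ)) • A ⟨p.src, p.μ⟩) ∧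
      ((U ⟨p.src.shift p.μ, p.ν⟩ : Matrix.specialUnitaryGroup (Fin 2) ℂ) : Matrix (Fin 2) (Fin 2) ℂ) = exp ((Complex.I * (η : ℂ)) • A ⟨p.src.shift p.μ, p.ν⟩) ∧
      ((U ⟨p.src.shift p.ν, p.μ⟩ : Matrix.specialUnitaryGroup (Fin 2) ℂ) : Matrix (Fin 2) (Fin 2) ℂ) = exp ((Complex.I * (η : ℂ)) • A ⟨p.src.shift p.ν, p.μ⟩) ∧
      ((U ⟨p.src, p.ν⟩ : Matrix.specialUnitaryGroup (Fin 2) ℂ) : Matrix (Fin 2) (Fin 2) ℂ) = exp ((Complex.I * (η : ℂ)) • A ⟨p.src, p.ν⟩))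
    (hexp₀ : ∀ p, Tch p →
      ((U₀ ⟨p.src, p.μ⟩ : Matrix.specialUnitaryGroup (Fin 2) ℂ) : Matrix (Fin 2) (Fin 2) ℂ) = exp ((Complex.I * (η : ℂ)) • A₀ ⟨p.src, p.μ⟩) ∧
      ((U₀ ⟨p.src.shift p.μ, p.ν⟩ : Matrix.specialUnitaryGroup (Fin 2) ℂ) : Matrix (Fin 2) (Fin 2) ℂ) = exp ((Complex.I * (η : ℂ)) • A₀ ⟨p.src.shift p.μ, p.ν⟩) ∧
      ((U₀ ⟨p.src.shift p.ν, p.μ⟩ : Matrix.specialUnitaryGroup (Fin 2) ℂ) : Matrix (Fin 2) (Fin 2) ℂ) = exp ((Complex.I * (η : ℂ)) • A₀ ⟨p.src.shift p.ν, p.μ⟩) ∧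
      ((U₀ ⟨p.src, p.ν⟩ : Matrix.specialUnitaryGroup (Fin 2) ℂ) : Matrix (Fin 2) (Fin 2) ℂ) = exp ((Complex.I * (η : ℂ)) • A₀ ⟨p.src, p.ν⟩))
    (hoff : ∀ p, ¬ Tch p →
      (U ⟨p.src, p.μ⟩ = U₀ ⟨p.src, p.μ⟩ ∧ U ⟨p.src.shift p.μ, p.ν⟩ = U₀ ⟨p.src.shift p.μ, p.ν⟩ ∧ U ⟨p.src.shift p.ν, p.μ⟩ = U₀ ⟨p.src.shift p.ν, p.μ⟩ ∧
        U ⟨p.src, p.ν⟩ = U₀ ⟨p.src, p.ν⟩) ∧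
      (A ⟨p.src, p.μ⟩ = A₀ ⟨p.src, p.μ⟩ ∧ A ⟨p.src.shift p.μ, p.ν⟩ = A₀ ⟨p.src.shift p.μ, p.ν⟩ ∧ A ⟨p.src.shift p.ν, p.μ⟩ = A₀ ⟨p.src.shift p.ν, p.μ⟩ ∧
        A ⟨p.src, p.ν⟩ = A₀ ⟨p.src, p.ν⟩)) :
    wilsonAction4 U - ((fun A : PBond P j → Matrix (Fin 2) (Fin 2) ℂ => (∑ p : Plaq P j, (1 - (2 : ℂ)⁻¹ * Matrix.trace (exp ((Complex.I * (η : ℂ)) • A ⟨p.src, p.μ⟩) * exp ((Complex.I * (η : ℂ)) • A ⟨p.src.shift p.μ, p.ν⟩) * exp (-((Complex.I * (η : ℂ)) • A ⟨p.src.shift p.ν, p.μ⟩)) * exp (-((Complex.I * (η : ℂ)) • A ⟨p.src, p.ν⟩)))))) A).re =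
      wilsonAction4 U₀ - ((fun A : PBond P j → Matrix (Fin 2) (Fin 2) ℂ => (∑ p : Plaq P j, (1 - (2 : ℂ)⁻¹ * Matrix.trace (exp ((Complex.I * (η : ℂ)) • A ⟨p.src, p.μ⟩) * exp ((Complex.I * (η : ℂ)) • A ⟨p.src.shift p.μ, p.ν⟩) * exp (-((Complex.I * (η : ℂ)) • A ⟨p.src.shift p.ν, p.μ⟩)) * exp (-((Complex.I * (η : ℂ)) • A ⟨p.src, p.ν⟩)))))) A₀).re := by
  unfold wilsonAction4 wilsonAction
  simp only [one_mul, Complex.re_sum, ← Finset.sum_sub_distrib]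
  refine sum_congr rfl fun p _ => ?_
  by_cases hp : Tch p
  · obtain ⟨h₁, h₂, h₃, h₄⟩ := hexp p hp
    obtain ⟨g₁, g₂, g₃, g₄⟩ := hexp₀ p hp
    rw [one_sub_reTr_plaqHol_eq_re η A U p h₁ h₂ h₃ h₄ (hsa _) (hsa _), one_sub_reTr_plaqHol_eq_re η A₀ U₀ p g₁ g₂ g₃ g₄ (hsa₀ _) (hsa₀ _), sub_self, sub_self]
  · obtain ⟨⟨u₁, u₂, u₃, u₄⟩, ⟨a₁, a₂, a₃, a₄⟩⟩ := hoff p hp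
    have hU : GaugeField.plaqHol U p = GaugeField.plaqHol U₀ p := by
      unfold GaugeField.plaqHol
      rw [u₁, u₂, u₃, u₄]
    rw [hU, a₁, a₂, a₃, a₄]

end Split

/-! ## §3 Transfer of the minimum -/

/-- **TRANSFER OF THE MINIMUM**: if `wilsonAction4 (Φ X) − Re 𝒮_η(Y X)` is constant on `T` (takes at every `X ∈ T` its value at `A ∈ T`) and `A` minimises
`X ↦ wilsonAction4 (Φ X)` over `T`, then `A` minimises `X ↦ Re 𝒮_η(Y X)` over `T`. [cite: Balaban1985Variational, (150) p.301, (157) p.302] -/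
theorem isMinOn_re_action_of_isMinOn_wilsonAction4 {E : Type*} (T : Set E) (Φ : E → GaugeField P j (Matrix.specialUnitaryGroup (Fin 2) ℂ)) (g : E → ℝ) (A : E)
    (hsplit : ∀ X ∈ T, wilsonAction4 (Φ X) - g X = wilsonAction4 (Φ A) - g A) (hmin : IsMinOn (fun X => wilsonAction4 (Φ X)) T A) :
    IsMinOn g T A := by
  intro X hX
  have h1 : wilsonAction4 (Φ A) ≤ wilsonAction4 (Φ X) := hmin hX
  have h2 := hsplit X hX
  show g A ≤ g X
  linarith

/-! ## §4 The local S11: the trace pairing from a minimum through the LOCALISED competitor map -/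

section Local

variable {β' : Type*} [Fintype β']

/-- ★★ **S11 FOR THE LOCALISED COMPETITOR MAP.**  Data of ✓`tracePairing_of_isMinOn_dressed_wilson_su2` (domain family `Dm`, `η ≠ 0`, `W₀` with the gradient identity of the
GLOBAL chart action `𝒮_η`, `H`, `D`, the explicit `E`, the competitor set `T = {X | sa ∧ tr ∧ Q X = B ∧ X ∈ S₀}` open along lines at the minimiser `A ∈ T`, `D` differentiable
at `A`, the dressed fields `X − H(D X)` self-adjoint on `T`) EXCEPT that the competitor map `Φ` is the chart `↑(Φ X)(b) = e^{iη(X − H(D X))(b)}` ONLY on the sides of the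
plaquettes of an arbitrary family `Tch` (`hexp`), and OFF them the competitor and its dressed field agree with those of the minimiser (`hoff` — in the knit: every competitor is
pinned on the level-0 index bonds and `H(D ·)` vanishes there, census (L1)).  IF `A` minimises `X ↦ wilsonAction4 (Φ X)` over `T`, THEN the trace pairing of
`(A, W₀(A − H(D A)) + E A)` vanishes on `ker Q` against every `s • Et` (`Et` self-adjoint traceless) — VERBATIM the `hpair` binder of ✓`HalvingSitePackage.sitePackage_of_rows_L5`.
Proof: §2 + §3 turn the minimum into a minimum of `Re 𝒮_η ∘ dress` over `T`; then ✓`tracePairing_of_isMinOn_dressed_su2`.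
[cite: Balaban1985Variational, (5) p.278, (47) p.285, (80)-(89) pp.290-291, (99)-(100) p.293, (150) p.301, (157)-(158) p.302] -/
theorem tracePairing_of_isMinOn_localChart (Dm : Domains P) (η : ℝ) (hη : η ≠ 0)
    (W₀ : (PBond P 0 → Matrix (Fin 2) (Fin 2) ℂ) → (PBond P 0 → Matrix (Fin 2) (Fin 2) ℂ)) (hSd : Differentiable ℂ (fun A : PBond P 0 → Matrix (Fin 2) (Fin 2) ℂ => (∑ p : Plaq P 0, (1 - (2 : ℂ)⁻¹ * Matrix.trace (exp ((Complex.I * (η : ℂ)) • A ⟨p.src, p.μ⟩) * exp ((Complex.I * (η : ℂ)) • A ⟨p.src.shift p.μ, p.ν⟩) * exp (-((Complex.I * (η : ℂ)) • A ⟨p.src.shift p.ν, p.μ⟩)) * exp (-((Complex.I * (η : ℂ)) • A ⟨p.src, p.ν⟩)))))))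
    (hgrad : ∀ A δ : PBond P 0 → Matrix (Fin 2) (Fin 2) ℂ, fderiv ℂ (fun A : PBond P 0 → Matrix (Fin 2) (Fin 2) ℂ => (∑ p : Plaq P 0, (1 - (2 : ℂ)⁻¹ * Matrix.trace (exp ((Complex.I * (η : ℂ)) • A ⟨p.src, p.μ⟩) * exp ((Complex.I * (η : ℂ)) • A ⟨p.src.shift p.μ, p.ν⟩) * exp (-((Complex.I * (η : ℂ)) • A ⟨p.src.shift p.ν, p.μ⟩)) * exp (-((Complex.I * (η : ℂ)) • A ⟨p.src, p.ν⟩)))))) A δ =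
      ((η : ℂ) ^ 2 / 2) * ∑ p : Plaq P 0, Matrix.trace ((A ⟨p.src, p.μ⟩ + A ⟨p.src.shift p.μ, p.ν⟩ - A ⟨p.src.shift p.ν, p.μ⟩ - A ⟨p.src, p.ν⟩) * (δ ⟨p.src, p.μ⟩ + δ ⟨p.src.shift p.μ, p.ν⟩ - δ ⟨p.src.shift p.ν, p.μ⟩ - δ ⟨p.src, p.ν⟩)) + (η : ℂ) ^ 4 * ∑ b : PBond P 0, Matrix.trace (W₀ A b * δ b))
    (H : (β' → Matrix (Fin 2) (Fin 2) ℂ) →ₗ[ℂ] (PBond P 0 → Matrix (Fin 2) (Fin 2) ℂ))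
    (D : (PBond P 0 → Matrix (Fin 2) (Fin 2) ℂ) → (β' → Matrix (Fin 2) (Fin 2) ℂ))
    (E : (PBond P 0 → Matrix (Fin 2) (Fin 2) ℂ) → (PBond P 0 → Matrix (Fin 2) (Fin 2) ℂ))
    (hE : ∀ (Y : PBond P 0 → Matrix (Fin 2) (Fin 2) ℂ) (b : PBond P 0) (i j : Fin 2), E Y b i j = ((η : ℂ) ^ 4)⁻¹ *
      (-(((η : ℂ) ^ 2 / 2) * ∑ p : Plaq P 0, Matrix.trace ((H (D Y) ⟨p.src, p.μ⟩ + H (D Y) ⟨p.src.shift p.μ, p.ν⟩ - H (D Y) ⟨p.src.shift p.ν, p.μ⟩ - H (D Y) ⟨p.src, p.ν⟩) *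
          ((Pi.single b (Matrix.single j i (1 : ℂ)) : PBond P 0 → Matrix (Fin 2) (Fin 2) ℂ) ⟨p.src, p.μ⟩ + (Pi.single b (Matrix.single j i (1 : ℂ)) : PBond P 0 → Matrix (Fin 2) (Fin 2) ℂ) ⟨p.src.shift p.μ, p.ν⟩ -
            (Pi.single b (Matrix.single j i (1 : ℂ)) : PBond P 0 → Matrix (Fin 2) (Fin 2) ℂ) ⟨p.src.shift p.ν, p.μ⟩ - (Pi.single b (Matrix.single j i (1 : ℂ)) : PBond P 0 → Matrix (Fin 2) (Fin 2) ℂ) ⟨p.src, p.ν⟩)))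
        - ((η : ℂ) ^ 2 / 2) * ∑ p : Plaq P 0, Matrix.trace (((Y - H (D Y)) ⟨p.src, p.μ⟩ + (Y - H (D Y)) ⟨p.src.shift p.μ, p.ν⟩ - (Y - H (D Y)) ⟨p.src.shift p.ν, p.μ⟩ - (Y - H (D Y)) ⟨p.src, p.ν⟩) *
          (H (fderiv ℂ D Y (Pi.single b (Matrix.single j i (1 : ℂ)))) ⟨p.src, p.μ⟩ + H (fderiv ℂ D Y (Pi.single b (Matrix.single j i (1 : ℂ)))) ⟨p.src.shift p.μ, p.ν⟩ -
            H (fderiv ℂ D Y (Pi.single b (Matrix.single j i (1 : ℂ)))) ⟨p.src.shift p.ν, p.μ⟩ - H (fderiv ℂ D Y (Pi.single b (Matrix.single j i (1 : ℂ)))) ⟨p.src, p.ν⟩))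
        - (η : ℂ) ^ 4 * ∑ b' : PBond P 0, Matrix.trace (W₀ (Y - H (D Y)) b' * H (fderiv ℂ D Y (Pi.single b (Matrix.single j i (1 : ℂ)))) b')))
    {S₀ : Set (PBond P 0 → Matrix (Fin 2) (Fin 2) ℂ)} {Bdat : BondIdx Dm → Matrix (Fin 2) (Fin 2) ℂ}
    (Tch : Plaq P 0 → Prop)
    (Φ : (PBond P 0 → Matrix (Fin 2) (Fin 2) ℂ) → GaugeField P 0 (Matrix.specialUnitaryGroup (Fin 2) ℂ))
    (hΨsa : ∀ X ∈ {X : PBond P 0 → Matrix (Fin 2) (Fin 2) ℂ | (∀ b, IsSelfAdjoint (X b)) ∧ (∀ b, Matrix.trace (X b) = 0) ∧ (∀ c : BondIdx Dm, bondAvgIter (c.1.1 : ℕ) X c.1.2 = Bdat c) ∧ X ∈ S₀}, ∀ b, IsSelfAdjoint ((X - H (D X)) b))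
    (hexp : ∀ X ∈ {X : PBond P 0 → Matrix (Fin 2) (Fin 2) ℂ | (∀ b, IsSelfAdjoint (X b)) ∧ (∀ b, Matrix.trace (X b) = 0) ∧ (∀ c : BondIdx Dm, bondAvgIter (c.1.1 : ℕ) X c.1.2 = Bdat c) ∧ X ∈ S₀}, ∀ p, Tch p →
      ((Φ X ⟨p.src, p.μ⟩ : Matrix.specialUnitaryGroup (Fin 2) ℂ) : Matrix (Fin 2) (Fin 2) ℂ) = exp ((Complex.I * (η : ℂ)) • (X - H (D X)) ⟨p.src, p.μ⟩) ∧
      ((Φ X ⟨p.src.shift p.μ, p.ν⟩ : Matrix.specialUnitaryGroup (Fin 2) ℂ) : Matrix (Fin 2) (Fin 2) ℂ) = exp ((Complex.I * (η : ℂ)) • (X - H (D X)) ⟨p.src.shift p.μ, p.ν⟩) ∧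
      ((Φ X ⟨p.src.shift p.ν, p.μ⟩ : Matrix.specialUnitaryGroup (Fin 2) ℂ) : Matrix (Fin 2) (Fin 2) ℂ) = exp ((Complex.I * (η : ℂ)) • (X - H (D X)) ⟨p.src.shift p.ν, p.μ⟩) ∧
      ((Φ X ⟨p.src, p.ν⟩ : Matrix.specialUnitaryGroup (Fin 2) ℂ) : Matrix (Fin 2) (Fin 2) ℂ) = exp ((Complex.I * (η : ℂ)) • (X - H (D X)) ⟨p.src, p.ν⟩))
    {A : PBond P 0 → Matrix (Fin 2) (Fin 2) ℂ}
    (hoff : ∀ X ∈ {X : PBond P 0 → Matrix (Fin 2) (Fin 2) ℂ | (∀ b, IsSelfAdjoint (X b)) ∧ (∀ b, Matrix.trace (X b) = 0) ∧ (∀ c : BondIdx Dm, bondAvgIter (c.1.1 : ℕ) X c.1.2 = Bdat c) ∧ X ∈ S₀}, ∀ p, ¬ Tch p →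
      (Φ X ⟨p.src, p.μ⟩ = Φ A ⟨p.src, p.μ⟩ ∧ Φ X ⟨p.src.shift p.μ, p.ν⟩ = Φ A ⟨p.src.shift p.μ, p.ν⟩ ∧ Φ X ⟨p.src.shift p.ν, p.μ⟩ = Φ A ⟨p.src.shift p.ν, p.μ⟩ ∧
        Φ X ⟨p.src, p.ν⟩ = Φ A ⟨p.src, p.ν⟩) ∧
      ((X - H (D X)) ⟨p.src, p.μ⟩ = (A - H (D A)) ⟨p.src, p.μ⟩ ∧ (X - H (D X)) ⟨p.src.shift p.μ, p.ν⟩ = (A - H (D A)) ⟨p.src.shift p.μ, p.ν⟩ ∧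
        (X - H (D X)) ⟨p.src.shift p.ν, p.μ⟩ = (A - H (D A)) ⟨p.src.shift p.ν, p.μ⟩ ∧ (X - H (D X)) ⟨p.src, p.ν⟩ = (A - H (D A)) ⟨p.src, p.ν⟩))
    (hAsa : ∀ b, IsSelfAdjoint (A b)) (hAtr : ∀ b, Matrix.trace (A b) = 0) (hAQ : ∀ c : BondIdx Dm, bondAvgIter (c.1.1 : ℕ) A c.1.2 = Bdat c) (hAS : A ∈ S₀)
    (hS₀ : ∀ δ : PBond P 0 → Matrix (Fin 2) (Fin 2) ℂ, ∃ r : ℝ, 0 < r ∧ ∀ t : ℝ, |t| < r → A + t • δ ∈ S₀)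
    (hD : DifferentiableAt ℂ D A)
    (hmin : IsMinOn (fun X => wilsonAction4 (Φ X)) {X : PBond P 0 → Matrix (Fin 2) (Fin 2) ℂ | (∀ b, IsSelfAdjoint (X b)) ∧ (∀ b, Matrix.trace (X b) = 0) ∧ (∀ c : BondIdx Dm, bondAvgIter (c.1.1 : ℕ) X c.1.2 = Bdat c) ∧ X ∈ S₀} A) :
    ∀ s : PBond P 0 → ℝ, QE Dm (WithLp.toLp 2 s) = 0 → ∀ Et : Matrix (Fin 2) (Fin 2) ℂ, IsSelfAdjoint Et → Matrix.trace Et = 0 →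
    (((η : ℂ) ^ 2 / 2) * ∑ p : Plaq P 0, Matrix.trace ((A ⟨p.src, p.μ⟩ + A ⟨p.src.shift p.μ, p.ν⟩ - A ⟨p.src.shift p.ν, p.μ⟩ - A ⟨p.src, p.ν⟩) * (((s ⟨p.src, p.μ⟩ : ℝ) : ℂ) • Et + ((s ⟨p.src.shift p.μ, p.ν⟩ : ℝ) : ℂ) • Et - ((s ⟨p.src.shift p.ν, p.μ⟩ : ℝ) : ℂ) • Et - ((s ⟨p.src, p.ν⟩ : ℝ) : ℂ) • Et)) +
      (η : ℂ) ^ 4 * ∑ b : PBond P 0, Matrix.trace ((W₀ (A - H (D A)) b + E A b) * (((s b : ℝ) : ℂ) • Et))).re = 0 := by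
  have hAT : A ∈ {X : PBond P 0 → Matrix (Fin 2) (Fin 2) ℂ | (∀ b, IsSelfAdjoint (X b)) ∧ (∀ b, Matrix.trace (X b) = 0) ∧
      (∀ c : BondIdx Dm, bondAvgIter (c.1.1 : ℕ) X c.1.2 = Bdat c) ∧ X ∈ S₀} := ⟨hAsa, hAtr, hAQ, hAS⟩
  -- action splitting on `T`: the Wilson action of the local competitor and `Re 𝒮_η` of its dressed field differ by a constant
  have hsplit : ∀ X ∈ {X : PBond P 0 → Matrix (Fin 2) (Fin 2) ℂ | (∀ b, IsSelfAdjoint (X b)) ∧ (∀ b, Matrix.trace (X b) = 0) ∧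
      (∀ c : BondIdx Dm, bondAvgIter (c.1.1 : ℕ) X c.1.2 = Bdat c) ∧ X ∈ S₀},
      wilsonAction4 (Φ X) - ((fun A : PBond P 0 → Matrix (Fin 2) (Fin 2) ℂ => (∑ p : Plaq P 0, (1 - (2 : ℂ)⁻¹ * Matrix.trace (exp ((Complex.I * (η : ℂ)) • A ⟨p.src, p.μ⟩) * exp ((Complex.I * (η : ℂ)) • A ⟨p.src.shift p.μ, p.ν⟩) * exp (-((Complex.I * (η : ℂ)) • A ⟨p.src.shift p.ν, p.μ⟩)) * exp (-((Complex.I * (η : ℂ)) • A ⟨p.src, p.ν⟩)))))) (X - H (D X))).re =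
      wilsonAction4 (Φ A) - ((fun A : PBond P 0 → Matrix (Fin 2) (Fin 2) ℂ => (∑ p : Plaq P 0, (1 - (2 : ℂ)⁻¹ * Matrix.trace (exp ((Complex.I * (η : ℂ)) • A ⟨p.src, p.μ⟩) * exp ((Complex.I * (η : ℂ)) • A ⟨p.src.shift p.μ, p.ν⟩) * exp (-((Complex.I * (η : ℂ)) • A ⟨p.src.shift p.ν, p.μ⟩)) * exp (-((Complex.I * (η : ℂ)) • A ⟨p.src, p.ν⟩)))))) (A - H (D A))).re :=
    fun X hX => wilsonAction4_sub_re_action_eq η Tch (X - H (D X)) (A - H (D A)) (Φ X) (Φ A) (hΨsa X hX) (hΨsa A hAT)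
      (hexp X hX) (hexp A hAT) (hoff X hX)
  have hmin' : IsMinOn (fun X => ((fun A : PBond P 0 → Matrix (Fin 2) (Fin 2) ℂ => (∑ p : Plaq P 0, (1 - (2 : ℂ)⁻¹ * Matrix.trace (exp ((Complex.I * (η : ℂ)) • A ⟨p.src, p.μ⟩) * exp ((Complex.I * (η : ℂ)) • A ⟨p.src.shift p.μ, p.ν⟩) * exp (-((Complex.I * (η : ℂ)) • A ⟨p.src.shift p.ν, p.μ⟩)) * exp (-((Complex.I * (η : ℂ)) • A ⟨p.src, p.ν⟩)))))) (X - H (D X))).re)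
      {X : PBond P 0 → Matrix (Fin 2) (Fin 2) ℂ | (∀ b, IsSelfAdjoint (X b)) ∧ (∀ b, Matrix.trace (X b) = 0) ∧ (∀ c : BondIdx Dm, bondAvgIter (c.1.1 : ℕ) X c.1.2 = Bdat c) ∧ X ∈ S₀} A :=
    isMinOn_re_action_of_isMinOn_wilsonAction4 _ Φ _ A hsplit hmin
  exact tracePairing_of_isMinOn_dressed_su2 Dm η hη (fun A : PBond P 0 → Matrix (Fin 2) (Fin 2) ℂ => (∑ p : Plaq P 0, (1 - (2 : ℂ)⁻¹ * Matrix.trace (exp ((Complex.I * (η : ℂ)) • A ⟨p.src, p.μ⟩) * exp ((Complex.I * (η : ℂ)) • A ⟨p.src.shift p.μ, p.ν⟩) * exp (-((Complex.I * (η : ℂ)) • A ⟨p.src.shift p.ν, p.μ⟩)) * exp (-((Complex.I * (η : ℂ)) • A ⟨p.src, p.ν⟩))))))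
    W₀ hSd hgrad H D E hE hAsa hAtr hAQ hS₀ hD hmin'

end Local

end Summit.QuantumFields.YangMills.Theorems.HalvingCompetitorMapAction

end
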